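import Mathlib
import Literature.Computability.AlgebraicComplexity.NewtonPolygonTauTransfer

/-!
# Crux `WordPerSuperPoly` (stmt-ValiantsHypothesis-6626), line `Sketch` — stub `stub_wordSubstTerm`
# (T1): affine elementary words specialise under term substitutions

Supports `Summit.ValiantsHypothesis.ValiantsHypothesis.Theses.ElementaryWordLength.WordPerSuperPoly`
(route `ElementaryWordLength`), line `Sketch` (card `newton-shadow-word-tau`), registered stub T1.

A letter of a crux word is `l : Fin 3 × Fin 3 × ℂ × Option σ`, read as the elementary matrix
`E_{l.1 l.2.1}(λ)` (`l.2.2.2 = none`) or `E_{l.1 l.2.1}(λ · x_s)` (`l.2.2.2 = some s`), `λ = l.2.2.1`,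
i.e. `Matrix.transvection l.1 l.2.1 (C λ * l.2.2.2.elim 1 X)` over `MvPolynomial σ ℂ`; a sparse
bivariate letter `(i, j, μ, (a, b))` is `E_{ij}(μ · X^a Y^b)` over `ℂ[X, Y] = MvPolynomial (Fin 2) ℂ`
(`X = X 0`, `Y = X 1`).  If every `v s` is a term, `v s = monomial (m s) (c s) = c_s X^{m_s 0} Y^{m_s 1}`,
then applying the algebra hom `aeval v` entrywise (`Matrix.map`) to a word whose matrix is
`E_13(f)` gives the sparse bivariate word with letters
`(i, j, λ, none) ↦ (i, j, λ, (0, 0))`, `(i, j, λ, some s) ↦ (i, j, λ c_s, (m_s 0, m_s 1))`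
(same length, same index pairs), whose matrix is `E_13(f(v))`; its `(0, 2)` entry is `aeval v f`.
Pure algebra over Mathlib (`Matrix.map_mul`, `Matrix.map_one`, `Matrix.map_single`,
`MvPolynomial.monomial_eq`) plus the definition `IsMvTerm` of the tree
(`Literature/Computability/AlgebraicComplexity/NewtonPolygonTauTransfer.lean`).
-/

-- `Summit.ValiantsHypothesis.ValiantsHypothesis.…` is the tree's mandated single-conjunct layout.
set_option linter.dupNamespace false

namespace Summit.ValiantsHypothesis.ValiantsHypothesis.Theorems.ElementaryWordLengthWordPerSuperPoly

open MvPolynomial Literature.Computability.AlgebraicComplexity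

/-- `wordProd⟦w⟧` (local notation, not a definition; verbatim the line skeleton's): the matrix of a
crux word `w` — the product of its letters `E_{ij}(c)` (`none`) / `E_{ij}(c·x_s)` (`some s`). -/
local notation3 (prettyPrint := false) "wordProd⟦" w "⟧" =>
  List.prod (List.map (fun l =>
    Matrix.transvection l.1 l.2.1 (MvPolynomial.C l.2.2.1 * l.2.2.2.elim 1 MvPolynomial.X)) w)

/-- `sparseEntry⟦w⟧` (local notation, not a definition; verbatim the line skeleton's): the `(0,2)`
entry of the product of a sparse bivariate word, letters `(i, j, c, (a, b)) ↦ E_{ij}(c · x^a y^b)`. -/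
local notation3 (prettyPrint := false) "sparseEntry⟦" w "⟧" =>
  List.prod (List.map (fun l : Fin 3 × Fin 3 × ℂ × (ℕ × ℕ) =>
    Matrix.transvection l.1 l.2.1
      (MvPolynomial.C l.2.2.1 * (MvPolynomial.X 0 ^ l.2.2.2.1 * MvPolynomial.X 1 ^ l.2.2.2.2) :
        MvPolynomial (Fin 2) ℂ)) w) 0 2

namespace WordSubstTerm

/-- A ring homomorphism applied entrywise maps a transvection `E_{ij}(c) = 1 + c e_{ij}` to the
transvection `E_{ij}(g c)`. [folklore] -/
theorem transvection_map {n R S F : Type*} [DecidableEq n] [CommRing R] [CommRing S]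
    [FunLike F R S] [RingHomClass F R S] (g : F) (i j : n) (c : R) :
    (Matrix.transvection i j c).map g = Matrix.transvection i j (g c) := by
  rw [Matrix.transvection, Matrix.transvection, Matrix.map_add _ (map_add g),
    Matrix.map_one g (map_zero g) (map_one g), Matrix.map_single]

/-- The `(i, j)` entry of the transvection `E_{ij}(c)` is `c` when `i ≠ j`. [folklore] -/
theorem transvection_apply_of_ne {n R : Type*} [DecidableEq n] [CommRing R] {i j : n} (h : i ≠ j)
    (c : R) : Matrix.transvection i j c i j = c := by
  rw [Matrix.transvection, Matrix.add_apply, Matrix.one_apply_ne h, Matrix.single_apply_same,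
    zero_add]

/-- A monomial of `R[X, Y] = MvPolynomial (Fin 2) R` is `c · X^{m 0} Y^{m 1}`. [folklore] -/
theorem monomial_fin_two {R : Type*} [CommSemiring R] (m : Fin 2 →₀ ℕ) (c : R) :
    (monomial m c : MvPolynomial (Fin 2) R) = C c * (X 0 ^ m 0 * X 1 ^ m 1) := by
  rw [monomial_eq, Finsupp.prod_pow, Fin.prod_univ_two]

end WordSubstTerm

open WordSubstTerm

/-- **T1 (words specialise under term substitutions).** If every `v s` is a term
`c · X^a Y^b` of `ℂ[X, Y]`, then substituting `v` for the variables of an affine elementary word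
whose matrix is `E_13(f)` gives a sparse bivariate word (letters `E_{ij}(μ X^a Y^b)`), no longer,
with the same off-diagonal index pairs, whose `(0, 2)` entry is `f(v) = aeval v f`: apply the
algebra hom `aeval v` entrywise; `E_{ij}(λ) ↦ E_{ij}(λ)` and
`E_{ij}(λ x_s) ↦ E_{ij}(λ c_s X^{m_s 0} Y^{m_s 1})` when `v s = monomial m_s c_s`. [folklore] -/
theorem stub_wordSubstTerm :
    ∀ {σ : Type} (f : MvPolynomial σ ℂ) (v : σ → MvPolynomial (Fin 2) ℂ),
      (∀ s, IsMvTerm (v s)) →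
      ∀ w : List (Fin 3 × Fin 3 × ℂ × Option σ), (∀ l ∈ w, l.1 ≠ l.2.1) →
        wordProd⟦w⟧ = Matrix.transvection (0 : Fin 3) 2 f →
        ∃ w' : List (Fin 3 × Fin 3 × ℂ × (ℕ × ℕ)), w'.length ≤ w.length ∧
          (∀ l ∈ w', l.1 ≠ l.2.1) ∧ sparseEntry⟦w'⟧ = aeval v f := by
  intro σ f v hv w hw hprod
  -- every `v s` is the term `monomial (m s) (c s)`
  have hv' : ∀ s, ∃ (ms : Fin 2 →₀ ℕ) (cs : ℂ), v s = monomial ms cs := hv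
  choose m c hmc using hv'
  -- the specialised word: letter map `(i, j, λ, none) ↦ (i, j, λ, (0, 0))`,
  -- `(i, j, λ, some s) ↦ (i, j, λ c_s, (m_s 0, m_s 1))`
  refine ⟨w.map (fun l => (l.1, l.2.1, l.2.2.2.elim l.2.2.1 (fun s => l.2.2.1 * c s),
    l.2.2.2.elim ((0, 0) : ℕ × ℕ) (fun s => (m s 0, m s 1)))), by simp, ?_, ?_⟩
  · intro l hl
    obtain ⟨l', hl', rfl⟩ := List.mem_map.1 hl
    exact hw l' hl'
  · -- each letter maps to the corresponding sparse letter under entrywise `aeval v`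
    have hletter : ∀ l : Fin 3 × Fin 3 × ℂ × Option σ,
        (Matrix.transvection l.1 l.2.1
            (MvPolynomial.C l.2.2.1 * l.2.2.2.elim 1 MvPolynomial.X : MvPolynomial σ ℂ)).map
            (MvPolynomial.aeval v) =
          (fun l' : Fin 3 × Fin 3 × ℂ × (ℕ × ℕ) => Matrix.transvection l'.1 l'.2.1
            (MvPolynomial.C l'.2.2.1 *
              (MvPolynomial.X 0 ^ l'.2.2.2.1 * MvPolynomial.X 1 ^ l'.2.2.2.2) :
                MvPolynomial (Fin 2) ℂ))
            ((fun l => (l.1, l.2.1, l.2.2.2.elim l.2.2.1 (fun s => l.2.2.1 * c s),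
              l.2.2.2.elim ((0, 0) : ℕ × ℕ) (fun s => (m s 0, m s 1)))) l) := by
      rintro ⟨i, j, a, _ | s⟩
      · rw [transvection_map]
        congr 1
        simp
      · rw [transvection_map]
        congr 1
        have hs := hmc s
        simp only [Option.elim_some, map_mul, MvPolynomial.aeval_C, MvPolynomial.aeval_X,
          MvPolynomial.algebraMap_eq, hs, monomial_fin_two]
        ring
    -- hence the word maps to the specialised word (entrywise `aeval v` is multiplicative)
    have key : ∀ u : List (Fin 3 × Fin 3 × ℂ × Option σ),
        ((u.map (fun l => Matrix.transvection l.1 l.2.1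
          (MvPolynomial.C l.2.2.1 * l.2.2.2.elim 1 MvPolynomial.X))).prod).map
            (MvPolynomial.aeval v) =
        ((u.map (fun l => (l.1, l.2.1, l.2.2.2.elim l.2.2.1 (fun s => l.2.2.1 * c s),
            l.2.2.2.elim ((0, 0) : ℕ × ℕ) (fun s => (m s 0, m s 1))))).map
          (fun l : Fin 3 × Fin 3 × ℂ × (ℕ × ℕ) => Matrix.transvection l.1 l.2.1
            (MvPolynomial.C l.2.2.1 *
              (MvPolynomial.X 0 ^ l.2.2.2.1 * MvPolynomial.X 1 ^ l.2.2.2.2) :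
                MvPolynomial (Fin 2) ℂ))).prod := by
      intro u
      induction u with
      | nil =>
        rw [List.map_nil, List.map_nil, List.map_nil, List.prod_nil, List.prod_nil]
        exact Matrix.map_one _ (map_zero _) (map_one _)
      | cons a u ih =>
        rw [List.map_cons, List.prod_cons, Matrix.map_mul, ih, hletter a, List.map_cons,
          List.map_cons, List.prod_cons]
    -- read off the `(0, 2)` entry of `E_13(f)` mapped by `aeval v`
    rw [← key w, hprod, transvection_map]
    exact transvection_apply_of_ne (by decide) _

end Summit.ValiantsHypothesis.ValiantsHypothesis.Theorems.ElementaryWordLengthWordPerSuperPoly
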